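import Summits.Ventures.PercRepro2.CaseOneStar

/-!
# The gadget `u ~ {w, o, b}`, `w ~ {u, a₁, a₂}` — pointwise structure (two adjacent unmarked centres)
(blind cell PercRepro2, p1 g16; S5 §2.1 (K9) (l): the first unmarked-neighbour class of the pairwise cone)

`IsGadgetUWOB`: the five edges `euw = {w, u}`, `euo = {o, u}`, `eub = {b, u}`, `ewa1 = {a₁, w}`,
`ewa2 = {a₂, w}` are all the edges at `u` and at `w`. With all five closed both centres are isolated
(`base5`); the bridge invariant of `CaseOneStar.lean` is applied TWICE: stage 1 opens the two root edges of
`w` (centre `w` over the base; `u` is still isolated), stage 2 opens the three edges of `u` (centre `u`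
over the stage-1 configuration). So **`conn_open5_iff`** reads a connection among vertices `≠ u` in
`open5` as a connection in the stage-1 configuration or one through `u` via two open neighbours of `u`
(in `{w, o, b}`), and **`conn_stage1_iff`** / **`conn_stage1_w_iff`** read the stage-1 connections in the
base (`w` bridges its open root neighbours). The quintuple pinning, the cells and the masses are the
same architecture as the marked star (`CaseOneStarPin.lean` …), to be generated from these lemmas. -/

namespace Summit.Ventures.PercRepro2

namespace CaseOne

section Gadget
variable {V : Type*} {E : Type*} [DecidableEq E]

/-- **The gadget**: `u`'s edges are exactly `euw, euo, eub` and `w`'s edges exactly `euw, ewa1, ewa2`. -/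
structure IsGadgetUWOB (ends : E → Sym2 V) (o a₁ a₂ b u w : V) (euw euo eub ewa1 ewa2 : E) : Prop where
  /-- the edge `{w, u}` -/
  ends_uw : ends euw = s(w, u)
  /-- the edge `{o, u}` -/
  ends_uo : ends euo = s(o, u)
  /-- the edge `{b, u}` -/
  ends_ub : ends eub = s(b, u)
  /-- the edge `{a₁, w}` -/
  ends_wa1 : ends ewa1 = s(a₁, w)
  /-- the edge `{a₂, w}` -/
  ends_wa2 : ends ewa2 = s(a₂, w)
  /-- distinct edges -/
  ne_uw_uo : euw ≠ euo
  /-- distinct edges -/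
  ne_uw_ub : euw ≠ eub
  /-- distinct edges -/
  ne_uw_wa1 : euw ≠ ewa1
  /-- distinct edges -/
  ne_uw_wa2 : euw ≠ ewa2
  /-- distinct edges -/
  ne_uo_ub : euo ≠ eub
  /-- distinct edges -/
  ne_uo_wa1 : euo ≠ ewa1
  /-- distinct edges -/
  ne_uo_wa2 : euo ≠ ewa2
  /-- distinct edges -/
  ne_ub_wa1 : eub ≠ ewa1
  /-- distinct edges -/
  ne_ub_wa2 : eub ≠ ewa2
  /-- distinct edges -/
  ne_wa1_wa2 : ewa1 ≠ ewa2
  /-- no other edge at `u` -/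
  unique_u : ∀ e, u ∈ ends e → e = euw ∨ e = euo ∨ e = eub
  /-- no other edge at `w` -/
  unique_w : ∀ e, w ∈ ends e → e = euw ∨ e = ewa1 ∨ e = ewa2
  /-- `w ≠ u` -/
  ne_wu : w ≠ u
  /-- `o ≠ u` -/
  ne_ou : o ≠ u
  /-- `b ≠ u` -/
  ne_bu : b ≠ u
  /-- `a₁ ≠ u` -/
  ne_a1u : a₁ ≠ u
  /-- `a₂ ≠ u` -/
  ne_a2u : a₂ ≠ u
  /-- `a₁ ≠ w` -/
  ne_a1w : a₁ ≠ w
  /-- `a₂ ≠ w` -/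
  ne_a2w : a₂ ≠ w
  /-- `o ≠ w` -/
  ne_ow : o ≠ w
  /-- `b ≠ w` -/
  ne_bw : b ≠ w

variable {ends : E → Sym2 V} {o a₁ a₂ b u w : V} {euw euo eub ewa1 ewa2 : E}

/-- The configuration with the five gadget edges closed. -/
def base5 (euw euo eub ewa1 ewa2 : E) (ω : Config E) : Config E :=
  Function.update (Function.update (Function.update (Function.update (Function.update ω euw false) euo false)
    eub false) ewa1 false) ewa2 false

/-- The stage-1 configuration: the root edges of `w` in the states `c₁, c₂` (from the base). -/
def stage1 (euw euo eub ewa1 ewa2 : E) (c₁ c₂ : Bool) (ω : Config E) : Config E :=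
  Function.update (Function.update (base5 euw euo eub ewa1 ewa2 ω) ewa1 c₁) ewa2 c₂

/-- The configuration with the five gadget edges in the states `(cw, co, cb)` at `u` and `(c₁, c₂)` at `w`. -/
def open5 (euw euo eub ewa1 ewa2 : E) (cw co cb c₁ c₂ : Bool) (ω : Config E) : Config E :=
  Function.update (Function.update (Function.update (stage1 euw euo eub ewa1 ewa2 c₁ c₂ ω) euw cw) euo co)
    eub cb

/-- The open root neighbours of `w`. -/
def nbrW (a₁ a₂ : V) (c₁ c₂ : Bool) (v : V) : Prop := (c₁ = true ∧ v = a₁) ∨ (c₂ = true ∧ v = a₂)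

/-- The open neighbours of `u`. -/
def nbrU (w o b : V) (cw co cb : Bool) (v : V) : Prop :=
  (cw = true ∧ v = w) ∨ (co = true ∧ v = o) ∨ (cb = true ∧ v = b)

omit [DecidableEq E] in
/-- A configuration in which a vertex is isolated satisfies the bridge invariant with no neighbour. -/
lemma bridgeInv_of_isolated {c : V} {ω : Config E} (hiso : ∀ x, x ≠ c → ¬ Conn ends ω x c) :
    BridgeInv ends c ω ω (fun _ => False) := by
  refine ⟨fun x y _ _ => ?_, fun x hx => ?_⟩
  · constructor
    · exact fun hc => Or.inl hc
    · rintro (hc | ⟨u', v', hu', _, _, _⟩)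
      · exact hc
      · exact hu'.elim
  · constructor
    · exact fun hc => absurd hc (hiso x hx)
    · rintro ⟨u', hu', _⟩
      exact hu'.elim

omit [DecidableEq E] in
/-- With its three edges closed, `u` is isolated. -/
lemma isolated_u (h : IsGadgetUWOB ends o a₁ a₂ b u w euw euo eub ewa1 ewa2) {ω : Config E}
    (h1 : ω euw = false) (h2 : ω euo = false) (h3 : ω eub = false) {x : V} (hx : Conn ends ω u x) :
    x = u := by
  have hS : ∀ y ∈ ({u} : Set V), ∀ z, (openGraph ends ω).Adj y z → z ∈ ({u} : Set V) := by
    intro y hy z hyz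
    rw [Set.mem_singleton_iff] at hy
    rw [hy] at hyz
    obtain ⟨_, e, he, hends⟩ := openGraph_adj.1 hyz
    have hu : u ∈ ends e := by rw [hends]; exact Sym2.mem_mk_left _ _
    rcases h.unique_u e hu with rfl | rfl | rfl
    · rw [h1] at he; exact Bool.noConfusion he
    · rw [h2] at he; exact Bool.noConfusion he
    · rw [h3] at he; exact Bool.noConfusion he
  exact mem_of_conn_of_closed hS (Set.mem_singleton u) hx

omit [DecidableEq E] in
/-- With its three edges closed, `w` is isolated. -/
lemma isolated_w (h : IsGadgetUWOB ends o a₁ a₂ b u w euw euo eub ewa1 ewa2) {ω : Config E}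
    (h1 : ω euw = false) (h2 : ω ewa1 = false) (h3 : ω ewa2 = false) {x : V} (hx : Conn ends ω w x) :
    x = w := by
  have hS : ∀ y ∈ ({w} : Set V), ∀ z, (openGraph ends ω).Adj y z → z ∈ ({w} : Set V) := by
    intro y hy z hyz
    rw [Set.mem_singleton_iff] at hy
    rw [hy] at hyz
    obtain ⟨_, e, he, hends⟩ := openGraph_adj.1 hyz
    have hw : w ∈ ends e := by rw [hends]; exact Sym2.mem_mk_left _ _
    rcases h.unique_w e hw with rfl | rfl | rfl
    · rw [h1] at he; exact Bool.noConfusion he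
    · rw [h2] at he; exact Bool.noConfusion he
    · rw [h3] at he; exact Bool.noConfusion he
  exact mem_of_conn_of_closed hS (Set.mem_singleton w) hx

/-- `base5` has the five edges closed. -/
lemma base5_uw (h : IsGadgetUWOB ends o a₁ a₂ b u w euw euo eub ewa1 ewa2) (ω : Config E) :
    base5 euw euo eub ewa1 ewa2 ω euw = false := by
  simp [base5, Function.update_of_ne h.ne_uw_wa2, Function.update_of_ne h.ne_uw_wa1,
    Function.update_of_ne h.ne_uw_ub, Function.update_of_ne h.ne_uw_uo]

/-- `base5` has the five edges closed. -/
lemma base5_uo (h : IsGadgetUWOB ends o a₁ a₂ b u w euw euo eub ewa1 ewa2) (ω : Config E) :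
    base5 euw euo eub ewa1 ewa2 ω euo = false := by
  simp [base5, Function.update_of_ne h.ne_uo_wa2, Function.update_of_ne h.ne_uo_wa1,
    Function.update_of_ne h.ne_uo_ub]

/-- `base5` has the five edges closed. -/
lemma base5_ub (h : IsGadgetUWOB ends o a₁ a₂ b u w euw euo eub ewa1 ewa2) (ω : Config E) :
    base5 euw euo eub ewa1 ewa2 ω eub = false := by
  simp [base5, Function.update_of_ne h.ne_ub_wa2, Function.update_of_ne h.ne_ub_wa1]

/-- `base5` has the five edges closed. -/
lemma base5_wa1 (h : IsGadgetUWOB ends o a₁ a₂ b u w euw euo eub ewa1 ewa2) (ω : Config E) :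
    base5 euw euo eub ewa1 ewa2 ω ewa1 = false := by
  simp [base5, Function.update_of_ne h.ne_wa1_wa2]

/-- `base5` has the five edges closed. -/
lemma base5_wa2 (ω : Config E) : base5 euw euo eub ewa1 ewa2 ω ewa2 = false := by simp [base5]

/-- The stage-1 configuration has the three edges of `u` closed. -/
lemma stage1_uw (h : IsGadgetUWOB ends o a₁ a₂ b u w euw euo eub ewa1 ewa2) (c₁ c₂ : Bool) (ω : Config E) :
    stage1 euw euo eub ewa1 ewa2 c₁ c₂ ω euw = false := by
  simp [stage1, Function.update_of_ne h.ne_uw_wa2, Function.update_of_ne h.ne_uw_wa1, base5_uw h ω]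

/-- The stage-1 configuration has the three edges of `u` closed. -/
lemma stage1_uo (h : IsGadgetUWOB ends o a₁ a₂ b u w euw euo eub ewa1 ewa2) (c₁ c₂ : Bool) (ω : Config E) :
    stage1 euw euo eub ewa1 ewa2 c₁ c₂ ω euo = false := by
  simp [stage1, Function.update_of_ne h.ne_uo_wa2, Function.update_of_ne h.ne_uo_wa1, base5_uo h ω]

/-- The stage-1 configuration has the three edges of `u` closed. -/
lemma stage1_ub (h : IsGadgetUWOB ends o a₁ a₂ b u w euw euo eub ewa1 ewa2) (c₁ c₂ : Bool) (ω : Config E) :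
    stage1 euw euo eub ewa1 ewa2 c₁ c₂ ω eub = false := by
  simp [stage1, Function.update_of_ne h.ne_ub_wa2, Function.update_of_ne h.ne_ub_wa1, base5_ub h ω]

/-- **Stage 1: `w` bridges its open root neighbours** over the base. -/
theorem bridgeInv_stage1 (h : IsGadgetUWOB ends o a₁ a₂ b u w euw euo eub ewa1 ewa2) (ω : Config E)
    (c₁ c₂ : Bool) :
    BridgeInv ends w (base5 euw euo eub ewa1 ewa2 ω) (stage1 euw euo eub ewa1 ewa2 c₁ c₂ ω)
      (nbrW a₁ a₂ c₁ c₂) := by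
  have s0 : BridgeInv ends w (base5 euw euo eub ewa1 ewa2 ω) (base5 euw euo eub ewa1 ewa2 ω)
      (fun _ => False) :=
    bridgeInv_of_isolated fun x hx hc =>
      hx (isolated_w h (base5_uw h ω) (base5_wa1 h ω) (base5_wa2 ω) (conn_symm hc))
  have s1 := bridgeInv_flag h.ends_wa1 h.ne_a1w s0 c₁ (base5_wa1 h ω)
  have s2 := bridgeInv_flag h.ends_wa2 h.ne_a2w s1 c₂
    (by rw [Function.update_of_ne h.ne_wa1_wa2.symm]; exact base5_wa2 ω)
  refine bridgeInv_congr (fun v => ?_) s2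
  unfold nbrW
  tauto

/-- **Stage 2: `u` bridges its open neighbours** over the stage-1 configuration. -/
theorem bridgeInv_open5 (h : IsGadgetUWOB ends o a₁ a₂ b u w euw euo eub ewa1 ewa2) (ω : Config E)
    (cw co cb c₁ c₂ : Bool) :
    BridgeInv ends u (stage1 euw euo eub ewa1 ewa2 c₁ c₂ ω) (open5 euw euo eub ewa1 ewa2 cw co cb c₁ c₂ ω)
      (nbrU w o b cw co cb) := by
  have s0 : BridgeInv ends u (stage1 euw euo eub ewa1 ewa2 c₁ c₂ ω)
      (stage1 euw euo eub ewa1 ewa2 c₁ c₂ ω) (fun _ => False) :=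
    bridgeInv_of_isolated fun x hx hc =>
      hx (isolated_u h (stage1_uw h c₁ c₂ ω) (stage1_uo h c₁ c₂ ω) (stage1_ub h c₁ c₂ ω) (conn_symm hc))
  have s1 := bridgeInv_flag h.ends_uw h.ne_wu s0 cw (stage1_uw h c₁ c₂ ω)
  have s2 := bridgeInv_flag h.ends_uo h.ne_ou s1 co
    (by rw [Function.update_of_ne h.ne_uw_uo.symm]; exact stage1_uo h c₁ c₂ ω)
  have s3 := bridgeInv_flag h.ends_ub h.ne_bu s2 cb
    (by rw [Function.update_of_ne h.ne_uo_ub.symm, Function.update_of_ne h.ne_uw_ub.symm]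
        exact stage1_ub h c₁ c₂ ω)
  refine bridgeInv_congr (fun v => ?_) s3
  unfold nbrU
  tauto

/-- **Connections among vertices `≠ u`** in `open5`: in the stage-1 configuration, or through `u` via two
open neighbours of `u`. -/
theorem conn_open5_iff (h : IsGadgetUWOB ends o a₁ a₂ b u w euw euo eub ewa1 ewa2) (ω : Config E)
    (cw co cb c₁ c₂ : Bool) {x y : V} (hx : x ≠ u) (hy : y ≠ u) :
    Conn ends (open5 euw euo eub ewa1 ewa2 cw co cb c₁ c₂ ω) x y ↔
      Conn ends (stage1 euw euo eub ewa1 ewa2 c₁ c₂ ω) x y ∨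
        ∃ u' v', nbrU w o b cw co cb u' ∧ nbrU w o b cw co cb v' ∧
          Conn ends (stage1 euw euo eub ewa1 ewa2 c₁ c₂ ω) x u' ∧
          Conn ends (stage1 euw euo eub ewa1 ewa2 c₁ c₂ ω) v' y :=
  (bridgeInv_open5 h ω cw co cb c₁ c₂).1 x y hx hy

/-- **Connections to `u`** in `open5`: `x ↔ u` iff `x ↔ u'` in the stage-1 configuration for an open
neighbour `u'` of `u`. -/
theorem conn_open5_u_iff (h : IsGadgetUWOB ends o a₁ a₂ b u w euw euo eub ewa1 ewa2) (ω : Config E)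
    (cw co cb c₁ c₂ : Bool) {x : V} (hx : x ≠ u) :
    Conn ends (open5 euw euo eub ewa1 ewa2 cw co cb c₁ c₂ ω) x u ↔
      ∃ u', nbrU w o b cw co cb u' ∧ Conn ends (stage1 euw euo eub ewa1 ewa2 c₁ c₂ ω) x u' :=
  (bridgeInv_open5 h ω cw co cb c₁ c₂).2 x hx

/-- **Stage-1 connections among vertices `≠ w`**: in the base, or through `w` via two open root
neighbours. -/
theorem conn_stage1_iff (h : IsGadgetUWOB ends o a₁ a₂ b u w euw euo eub ewa1 ewa2) (ω : Config E)
    (c₁ c₂ : Bool) {x y : V} (hx : x ≠ w) (hy : y ≠ w) :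
    Conn ends (stage1 euw euo eub ewa1 ewa2 c₁ c₂ ω) x y ↔
      Conn ends (base5 euw euo eub ewa1 ewa2 ω) x y ∨
        ∃ u' v', nbrW a₁ a₂ c₁ c₂ u' ∧ nbrW a₁ a₂ c₁ c₂ v' ∧
          Conn ends (base5 euw euo eub ewa1 ewa2 ω) x u' ∧ Conn ends (base5 euw euo eub ewa1 ewa2 ω) v' y :=
  (bridgeInv_stage1 h ω c₁ c₂).1 x y hx hy

/-- **Stage-1 connections to `w`**: `x ↔ w` iff `x ↔ a root` in the base for an open root neighbour. -/
theorem conn_stage1_w_iff (h : IsGadgetUWOB ends o a₁ a₂ b u w euw euo eub ewa1 ewa2) (ω : Config E)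
    (c₁ c₂ : Bool) {x : V} (hx : x ≠ w) :
    Conn ends (stage1 euw euo eub ewa1 ewa2 c₁ c₂ ω) x w ↔
      ∃ u', nbrW a₁ a₂ c₁ c₂ u' ∧ Conn ends (base5 euw euo eub ewa1 ewa2 ω) x u' :=
  (bridgeInv_stage1 h ω c₁ c₂).2 x hx

/-- **Stage-1 connections from `w`** (the centre first). -/
theorem conn_stage1_w_iff' (h : IsGadgetUWOB ends o a₁ a₂ b u w euw euo eub ewa1 ewa2) (ω : Config E)
    (c₁ c₂ : Bool) {y : V} (hy : y ≠ w) :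
    Conn ends (stage1 euw euo eub ewa1 ewa2 c₁ c₂ ω) w y ↔
      ∃ u', nbrW a₁ a₂ c₁ c₂ u' ∧ Conn ends (base5 euw euo eub ewa1 ewa2 ω) y u' := by
  rw [conn_comm_iff]
  exact conn_stage1_w_iff h ω c₁ c₂ hy

/-- **Connections from `u`** in `open5` (the centre first). -/
theorem conn_open5_u_iff' (h : IsGadgetUWOB ends o a₁ a₂ b u w euw euo eub ewa1 ewa2) (ω : Config E)
    (cw co cb c₁ c₂ : Bool) {y : V} (hy : y ≠ u) :
    Conn ends (open5 euw euo eub ewa1 ewa2 cw co cb c₁ c₂ ω) u y ↔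
      ∃ u', nbrU w o b cw co cb u' ∧ Conn ends (stage1 euw euo eub ewa1 ewa2 c₁ c₂ ω) y u' := by
  rw [conn_comm_iff]
  exact conn_open5_u_iff h ω cw co cb c₁ c₂ hy

/-- In the base, `u` is joined to nothing but itself. -/
lemma not_conn_base5_u (h : IsGadgetUWOB ends o a₁ a₂ b u w euw euo eub ewa1 ewa2) (ω : Config E)
    {x : V} (hx : x ≠ u) : ¬ Conn ends (base5 euw euo eub ewa1 ewa2 ω) x u :=
  fun hc => hx (isolated_u h (base5_uw h ω) (base5_uo h ω) (base5_ub h ω) (conn_symm hc))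

/-- In the base, `w` is joined to nothing but itself. -/
lemma not_conn_base5_w (h : IsGadgetUWOB ends o a₁ a₂ b u w euw euo eub ewa1 ewa2) (ω : Config E)
    {x : V} (hx : x ≠ w) : ¬ Conn ends (base5 euw euo eub ewa1 ewa2 ω) x w :=
  fun hc => hx (isolated_w h (base5_uw h ω) (base5_wa1 h ω) (base5_wa2 ω) (conn_symm hc))

/-- The base equals `ω` when the five edges are closed in `ω`. -/
lemma base5_eq_self {ω : Config E} (h1 : ω euw = false) (h2 : ω euo = false) (h3 : ω eub = false)
    (h4 : ω ewa1 = false) (h5 : ω ewa2 = false) : base5 euw euo eub ewa1 ewa2 ω = ω := by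
  funext e
  simp only [base5, Function.update_apply]
  split_ifs <;> simp_all

end Gadget

end CaseOne

end Summit.Ventures.PercRepro2
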